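import Summits.QuantumFields.YangMills.Theorems.UnitScaleTiltProp8FlatPortCurlCurlPairingL0
import Summits.QuantumFields.YangMills.Theorems.UnitScaleTiltProp8FlatPortKernelRowsAllL
import HarnessLib

/-!
# Route `UnitScaleTilt`, crux K1 child «MinimiserStabilityRegPr» (stmt-QuantumFields-19200), v8 pillar P2 — port level, **THE (X2-CH) BILINEAR CURL–CURL PAIRING OF `flatH`,
# EVERY ODD `L ≥ 3`**: the twin of ✓`UnitScaleTiltProp8FlatPortCurlCurlPairingL0` (`curlCurlPairing_domT`, `curlCurlPairing_of_adm22`) with the block-size floor `(hℓ : 4 ≤ ℓ)`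
# DELETED, reading Cor. 2.8 (2.151)₁,₂ through ✓`FlatPortCor28PadAllL.cor28_kLevel_H_DH_pad_allL` (lit-balaban's `B6Cor28EntriesKLevelV1L3`) and the recharting through
# ✓`FlatPortKernelRowsAllL.chart_params_allL`

Cell `ym3-torus` (HUMAN RULING D-0037, YM ladder rung R3), seat `ym-inputs-p09` (cell `pub/ym-inputs`, on-call hand; ★★OWNER RULING g26-№20 L-FLOOR LEDGER item LF-1 ∕
(P2-L3); LEAD ★w5-19200 g4 board 09:30Z).  `--supports stmt-QuantumFields-19200 --as helper`; count-neutral; def-free.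

WHAT IS PROVED (sorry-free; axioms standard; no definition): **`curlCurlPairing_domT_allL`**, **`curlCurlPairing_of_adm22_allL`** — the statements of the L0 file VERBATIM
minus the binder `(hℓ : 4 ≤ ℓ)`, at every charted ∕ every `Adm22` family, EVERY odd `L ≥ 3`.  Proof = the L0 proof verbatim (`hRows12_of_cor28Shape`, `colSum_domT`,
`globalBand_unitWeights`, `unitWeights_pos`, `theta_budget` and the generic pairing lemma of `…FlatHCurlCurlPairing` consumed BY NAME).
HONEST SCOPE: bookkeeping over lit-balaban's kernel-checked L3 chain (`…V1L3`, binder `4 ≤ ℓ` dropped) through the `_allL` pads; the torus-size binder `a′ + 3 ≤ m + n`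
stays ((P2-small), cured by the (α) cover); constants crude (L3 coercivity `γ₀ = (1/12)²/C_E` where it enters); nothing here proves `stub_halvingStep` or the crux;
YM₃ on T³ = rung R3, NOT the Clay problem, no mass-gap claim.

References: T. Bałaban, CMP **96** (1984) 223–250 [Balaban1984PropagatorsII] Cor. 2.8 (2.150)–(2.151) p.249, Lemma 2.1 (2.60)–(2.61) p.234; CMP **102** (1985) 277–309
[Balaban1985Variational] (157)–(158) p.302, (161)–(163) p.303.
-/

set_option autoImplicit false

noncomputable section

open scoped BigOperators InnerProductSpace

namespace Summit.QuantumFields.YangMills.Theorems.FlatPortCurlCurlPairingAllL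

open Literature.MathematicalPhysics.QuantumFieldTheory.Balaban1983to89
open B6MultiLevelBoxOperator (N0)
open B6MultiLevelTorusOperatorL0 (TDomains)
open B6Geom246MultiLevelTorusL0 (geomT bondT)
open B6GlobalChartV1 (PV toBox)
open B6GlobalChartV1L0 (blkV1 domT)
open B6Ineq2142KLevelV1L0 (β)
open B6Ineq261LevelGap (K261 K261_nonneg)
open B6Cor28KLevelV1 (two_le_RMh)
open B6CubeWindowV1 (GlobalBand)
open B6SectADomainsV1 (Domains)
open B6SectAOperatorsV1 (BondIdx dcE dcsE)
open T3ContinuumYM3Torus (T3Family)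
open FlatCubeOpsText (IsLevWeight)
open FlatOpsLettersAssembly (flatH)
open FlatHCurlCurlPairing (curlCurlPairing_of_row2)
open FlatPortHRows12 (cf_ne_zero)
open FlatPortHRows12L0 (hRows12_of_cor28Shape)
open FlatPortCor28PadAllL (cor28_kLevel_H_DH_pad_allL)
open FlatPortKernelRows (theta_budget)
open FlatPortKernelRowsAllL (chart_params_allL)
open FlatPortKernelRowsL0 (globalBand_unitWeights unitWeights_pos)
open FlatPortColumnSumL0 (colSum_domT)

/-- `1 ≤ 3` (named once; every `domT`/`PV` below carries the same proof term). [folklore] -/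
private theorem hd3 : 1 ≤ 2 + 1 := by norm_num

/-- ★★ **(X2-CH) AT EVERY CHARTED FAMILY OF THE d = 3 CARRIER, ODD `L ≥ 5`, `k ≥ 1`, CONSTANTS FROM `L` ALONE (`η⁻³` explicit)**: the `∂^{η*}∂^η`-pairing letter of the
canonical `flatH` against any field `Z` with gradient letter `≤ s` — (k2) of `hRows12_of_cor28Shape` (Cor. 2.8 (2.151)₂ at the unit band) and the transposed column sum
`colSum_domT` ((2.61) at rate `δ₅/2`), composed by `curlCurlPairing_of_row2`.
[cite: Balaban1985Variational, (88) p.291, (161)-(163) p.303; Balaban1984PropagatorsII, Cor. 2.8 (2.151) p.249, Lemma 2.1 (2.61) p.234; Balaban1984PropagatorsI, (1.2) p.18, (1.21) p.21] -/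
theorem curlCurlPairing_domT_allL (ℓ : ℕ) (hL : Odd (ℓ + 1) ∧ 1 < ℓ + 1) :
    ∃ (Mh₀ R₀ : ℕ) (CP : ℝ), 0 ≤ CP ∧
    ∀ (m : ℕ) (hm : 1 ≤ m) (n K : ℕ) {Mh R : ℕ} {P' : Fin (2 + 1) → ℕ} (hN : ∀ μ, N0 ℓ Mh (K - n) P' μ = (PV 2 ℓ m K hd3 hL).sitesPerDir 0)
      (D : TDomains 2 ℓ Mh (K - n) P' R) (hk : K - n ≤ m + K) (_ : 1 ≤ K - n) (_ : K - n + 1 ≤ m + K)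
      {P'' : Fin (2 + 1) → ℕ} (_ : ∀ μ, P' μ = (ℓ + 1) * P'' μ) (_ : ∀ μ, 5 ≤ P'' μ)
      {a : ℕ} (_ : Mh = (ℓ + 1) ^ a) (_ : Mh₀ ≤ Mh) (_ : R₀ ≤ R)
      (w : ℕ → PBond (PV 2 ℓ m K hd3 hL) 0 → ℝ) (_ : IsLevWeight (⟨ℓ + 1, hL, m, hm⟩ : T3Family) n K (B6GlobalChartV1L0.domT hN D hk) w)
      (Z : PBond (PV 2 ℓ m K hd3 hL) 0 → ℝ) (s : ℝ) (_ : 0 ≤ s)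
      (_ : ∀ (b : PBond (PV 2 ℓ m K hd3 hL) 0) (ν : Fin (2 + 1)),
        w 2 b * (((ℓ + 1 : ℕ) : ℝ)) ^ (K - n) * |Z ⟨b.src.shift ν, b.dir⟩ - Z b| ≤ s)
      (X : BondIdx (domT hN D hk) → ℝ),
        |∑ b : PBond (PV 2 ℓ m K hd3 hL) 0, (dcsE ((((ℓ + 1 : ℕ) : ℝ)) ^ (K - n)) (dcE ((((ℓ + 1 : ℕ) : ℝ)) ^ (K - n))
            (WithLp.toLp 2 (flatH (⟨ℓ + 1, hL, m, hm⟩ : T3Family) n K (domT hN D hk) X)))) b * Z b| ≤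
          CP * ((((ℓ + 1 : ℕ) : ℝ)) ^ (K - n)) ^ 3 * s * ∑ c, |X c| := by
  -- the (2.151) package at the unit band `b₀ = b₁ = 1`
  obtain ⟨σa, hσa, hA⟩ := cor28_kLevel_H_DH_pad_allL 2 ℓ hd3 hL one_pos (le_refl (1 : ℝ))
  obtain ⟨δ₅, C₅, M₂a, N₁a, hδ₅, hC₅, hM₂a, hrowsA⟩ := hA σa hσa le_rfl (1 / 2) (by norm_num) (by norm_num)
  -- ONE Lemma-2.1 budget at rate `δ₅/2` for the column sum
  obtain ⟨hN0pos, hθ0⟩ := theta_budget ℓ (show 0 < 1 / 2 * δ₅ by positivity)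
  set N0 : ℕ := ⌈2 * ((2 + 1 : ℕ) : ℝ) * Real.log ((ℓ : ℝ) + 1) / (1 / 2 * δ₅)⌉₊ + 1 with hN0
  -- the constants
  set Lr : ℝ := (ℓ : ℝ) + 1 with hLr
  have hL1 : (1 : ℝ) ≤ Lr := by rw [hLr]; linarith [(Nat.cast_nonneg ℓ : (0 : ℝ) ≤ ℓ)]
  set c1 : ℝ := K261 N0 (2 + 1) Lr 1 (1 / 2 * δ₅) with hc1
  have hc10 : 0 ≤ c1 := K261_nonneg (by linarith : (0 : ℝ) ≤ Lr) zero_le_one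
  set C₁ : ℝ := C₅ * Real.exp (3 * δ₅) with hC₁
  have hC₁0 : 0 ≤ C₁ := by positivity
  -- the thresholds on `M_h` and `R`
  set Mh₀ : ℕ := max 8 ⌈M₂a⌉₊ with hMh₀
  set R₀ : ℕ := max (2 * (ℓ + 1) ^ 2) (max (N₁a + 1) (N0 + 1)) with hR₀
  refine ⟨Mh₀, R₀, 4 * ((2 : ℝ) + 1) * C₁ * (3 * c1), by positivity, ?_⟩
  intro m hm n K Mh R P' hN D hk hk1 hk' P'' hLP hP5 a hMha hMh hR w hw Z s hs hZ X
  -- unpack the thresholds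
  have hM8 : 8 ≤ Mh := le_trans (le_max_left _ _) hMh
  have hMh1 : 1 ≤ Mh := le_trans (by norm_num) hM8
  have hR2 : 2 * (ℓ + 1) ^ 2 ≤ R := le_trans (le_max_left _ _) hR
  have hRLM : ∀ {N : ℕ}, N + 1 ≤ R₀ → N + 1 ≤ R * ((ℓ + 1) * Mh) := fun {N} h =>
    le_trans (le_trans h hR) (Nat.le_mul_of_pos_right R (Nat.mul_pos (Nat.succ_pos ℓ) (by omega)))
  have hN₁a : N₁a + 1 ≤ R * ((ℓ + 1) * Mh) := hRLM (le_trans (le_max_left _ _) (le_max_right _ _))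
  have hN0' : N0 + 1 ≤ R * ((ℓ + 1) * Mh) := hRLM (le_trans (le_max_right _ _) (le_max_right _ _))
  have hM₂a' : M₂a ≤ ((ℓ : ℝ) + 1) * Mh := by
    have h0 : ⌈M₂a⌉₊ ≤ Mh := le_trans (le_max_right _ _) hMh
    have h1 : M₂a ≤ (⌈M₂a⌉₊ : ℝ) := Nat.le_ceil _
    have h2 : (⌈M₂a⌉₊ : ℝ) ≤ (Mh : ℝ) := by exact_mod_cast h0
    have h3 : (Mh : ℝ) ≤ ((ℓ : ℝ) + 1) * Mh := le_mul_of_one_le_left (Nat.cast_nonneg _) hL1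
    linarith
  have hP1 : ∀ μ, 1 ≤ P' μ := fun μ => by rw [hLP μ]; exact Nat.mul_pos (Nat.succ_pos ℓ) (by have := hP5 μ; omega)
  -- the band weights
  set ws : BondIdx (domT hN D hk) → ℝ := fun i =>
    ((((ℓ + 1 : ℕ) : ℝ)) ^ (K - n) / (((ℓ + 1 : ℕ) : ℝ)) ^ (i.1.1 : ℕ)) ^ 2 * ((((ℓ + 1 : ℕ) : ℝ)) ^ (i.1.1 : ℕ)) ^ (2 + 1) with hws_def
  have hws : ∀ i, 0 < ws i := unitWeights_pos ℓ hL m n K hN D hk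
  have hband : GlobalBand (Dm := domT hN D hk) 1 1 ((((ℓ + 1 : ℕ) : ℝ)) ^ (K - n)) ws := globalBand_unitWeights ℓ hL m n K hN D hk
  -- (2.151)₁,₂ at these data
  obtain ⟨hH1, hH2⟩ := hrowsA m K hN D hk hk1 hk' hLP hP5 hMha hM8 hR2 hM₂a' hN₁a (cf_ne_zero ℓ n K) hws hband
  -- (k2) over `d_T + 3` at `(C₁, δ₅)`
  have hk2 : ∀ (c : BondIdx (domT hN D hk)) (e : BondIdx (domT hN D hk) → ℝ), e c = 1 → (∀ c', c' ≠ c → e c' = 0) →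
      ∀ (b : PBond (PV 2 ℓ m K hd3 hL) 0) (ν : Fin (2 + 1)),
        w 1 b * (((ℓ + 1 : ℕ) : ℝ)) ^ (K - n) *
          |flatH (⟨ℓ + 1, hL, m, hm⟩ : T3Family) n K (domT hN D hk) e ⟨b.src.shift ν, b.dir⟩ - flatH (⟨ℓ + 1, hL, m, hm⟩ : T3Family) n K (domT hN D hk) e b| ≤
        C₁ * Real.exp (-(δ₅ * (((bondT D).dist (blkV1 hN D b) (β hN D hk c) : ℝ) + 3))) :=
    fun c e he he' b ν => (hRows12_of_cor28Shape ℓ hL m hm n K hN D hk hws hH1 hH2 w hw c e he he' b).2 ν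
  -- the transposed column sum at rate `δ₅/2`, `u ≡ 1`
  have hcol : ∀ c : BondIdx (domT hN D hk),
      ∑ b : PBond (PV 2 ℓ m K hd3 hL) 0, (w 3 b)⁻¹ * Real.exp (-(1 / 2 * δ₅ * (((bondT D).dist (blkV1 hN D b) (β hN D hk c) : ℝ) + 3))) ≤
        (3 * ((((ℓ + 1 : ℕ) : ℝ)) ^ (K - n)) ^ 3 * c1) * (fun _ : BondIdx (domT hN D hk) => (1 : ℝ)) c := by
    intro c
    rw [mul_one]
    exact colSum_domT ℓ hL m hm n K hN D hk hMh1 hP1 hδ₅.le (by norm_num : (0 : ℝ) ≤ 1 / 2) (by norm_num : (1 : ℝ) / 2 ≤ 1) hN0pos hN0' hθ0 w hw c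
  have hδ' : 1 / 2 * δ₅ ≤ δ₅ := by linarith
  have hd0 : ∀ (b : PBond (PV 2 ℓ m K hd3 hL) 0) (c : BondIdx (domT hN D hk)), (0 : ℝ) ≤ ((bondT D).dist (blkV1 hN D b) (β hN D hk c) : ℝ) + 3 :=
    fun _ _ => by positivity
  have key := curlCurlPairing_of_row2 (F := (⟨ℓ + 1, hL, m, hm⟩ : T3Family)) (n := n) (K := K) (D := domT hN D hk) (w := w)
    (dBI := fun b c => ((bondT D).dist (blkV1 hN D b) (β hN D hk c) : ℝ) + 3) (H := flatH (⟨ℓ + 1, hL, m, hm⟩ : T3Family) n K (domT hN D hk))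
    (u := fun _ => (1 : ℝ)) hw hC₁0 hδ' hd0 hk2 hcol Z s hs hZ X
  have hd : ((((⟨ℓ + 1, hL, m, hm⟩ : T3Family).P K).d : ℕ) : ℝ) = (2 : ℝ) + 1 := by rw [T3Family.P_d]; norm_num
  calc |∑ b : PBond (PV 2 ℓ m K hd3 hL) 0, (dcsE ((((ℓ + 1 : ℕ) : ℝ)) ^ (K - n)) (dcE ((((ℓ + 1 : ℕ) : ℝ)) ^ (K - n))
          (WithLp.toLp 2 (flatH (⟨ℓ + 1, hL, m, hm⟩ : T3Family) n K (domT hN D hk) X)))) b * Z b|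
      ≤ (4 * ((((⟨ℓ + 1, hL, m, hm⟩ : T3Family).P K).d : ℕ) : ℝ) * C₁ * (3 * ((((ℓ + 1 : ℕ) : ℝ)) ^ (K - n)) ^ 3 * c1)) * s *
          ∑ c, (fun _ : BondIdx (domT hN D hk) => (1 : ℝ)) c * |X c| := key
    _ = 4 * ((2 : ℝ) + 1) * C₁ * (3 * c1) * ((((ℓ + 1 : ℕ) : ℝ)) ^ (K - n)) ^ 3 * s * ∑ c, |X c| := by
        rw [hd]
        simp only [one_mul]
        ring

/-- ★★ **(X2-CH) AT EVERY ADMISSIBLE FAMILY OF THE P2 TEXT** (level `0` admitted; via `FlatPortChartL0.tdOfAdmL0`∕`domT_tdOfAdmL0`): for odd `L = ℓ + 1 ≥ 3` there are `M_h⁰, R₀`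
and `C_P ≥ 0` such that for all `m ≥ 1`, heights `1 ≤ K − n`, `K − n + 1 ≤ m + K`, big blocks `M = L·M_h`, `M_h = L^{a′} ≥ M_h⁰`, `R ≥ R₀`, torus size `a′ + 3 ≤ m + n`, every
`D : Domains (F.P K)` with `D.k = K − n`, `Adm22 D R (L·M_h)`, every P2 weight family, every field `Z` with gradient letter `≤ s` and every `X`:
`|Σ_b (∂^{η*}∂^η flatH F n K D X)(b)·Z(b)| ≤ C_P·(L^{K−n})³·s·Σ_c |X c|` — the same data at which `kernelRowsAt_of_adm22` and `curlCurlSupRow_of_adm22` hold.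
[cite: Balaban1984PropagatorsII, (2.1)-(2.4) p.224, Cor. 2.8 (2.151) p.249, Lemma 2.1 (2.61) p.234; Balaban1985Variational, (88) p.291, (161)-(163) p.303] -/
theorem curlCurlPairing_of_adm22_allL (ℓ : ℕ) (hL : Odd (ℓ + 1) ∧ 1 < ℓ + 1) :
    ∃ (Mh₀ R₀ : ℕ) (CP : ℝ), 0 ≤ CP ∧
    ∀ (m : ℕ) (hm : 1 ≤ m) (n K : ℕ) (_ : 1 ≤ K - n) (_ : K - n + 1 ≤ m + K) {Mh R a' : ℕ} (_ : Mh = (ℓ + 1) ^ a') (_ : Mh₀ ≤ Mh) (_ : R₀ ≤ R) (_ : a' + 3 ≤ m + n)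
      (D : B6SectADomainsV1.Domains (PV 2 ℓ m K hd3 hL)) (_ : D.k = K - n) (_ : FlatCubeOpsText.Adm22 D R ((ℓ + 1) * Mh))
      (w : ℕ → PBond (PV 2 ℓ m K hd3 hL) 0 → ℝ) (_ : IsLevWeight (⟨ℓ + 1, hL, m, hm⟩ : T3Family) n K D w)
      (Z : PBond (PV 2 ℓ m K hd3 hL) 0 → ℝ) (s : ℝ) (_ : 0 ≤ s)
      (_ : ∀ (b : PBond (PV 2 ℓ m K hd3 hL) 0) (ν : Fin (2 + 1)),
        w 2 b * (((ℓ + 1 : ℕ) : ℝ)) ^ (K - n) * |Z ⟨b.src.shift ν, b.dir⟩ - Z b| ≤ s)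
      (X : BondIdx D → ℝ),
        |∑ b : PBond (PV 2 ℓ m K hd3 hL) 0, (dcsE ((((ℓ + 1 : ℕ) : ℝ)) ^ (K - n)) (dcE ((((ℓ + 1 : ℕ) : ℝ)) ^ (K - n))
            (WithLp.toLp 2 (flatH (⟨ℓ + 1, hL, m, hm⟩ : T3Family) n K D X)))) b * Z b| ≤
          CP * ((((ℓ + 1 : ℕ) : ℝ)) ^ (K - n)) ^ 3 * s * ∑ c, |X c| := by
  obtain ⟨Mh₀, R₀, CP, hCP, hmain⟩ := curlCurlPairing_domT_allL ℓ hL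
  refine ⟨Mh₀, R₀, CP, hCP, ?_⟩
  intro m hm n K hk1 hk' Mh R a' hMha hMh hR hsize D hDk hAdm w hw
  have hk : K - n ≤ m + K := by omega
  obtain ⟨hN, hLP, hP5⟩ := chart_params_allL ℓ m n K a' hL hk1 hsize
  rw [hMha] at hAdm
  have hN' : ∀ μ : Fin (2 + 1), N0 ℓ Mh (K - n) (fun _ => 2 * (ℓ + 1) ^ (m + n - 1 - a')) μ = (PV 2 ℓ m K hd3 hL).sitesPerDir 0 := by
    rw [hMha]; exact hN
  rw [← hMha] at hAdm
  set D' := FlatPortChartL0.tdOfAdmL0 hN' D hDk hk hAdm with hD'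
  have hEq : domT hN' D' hk = D := FlatPortChartL0.domT_tdOfAdmL0 hN' D hDk hk hAdm
  rw [← hEq] at hw ⊢
  exact hmain m hm n K hN' D' hk hk1 hk' hLP hP5 hMha hMh hR w hw

end Summit.QuantumFields.YangMills.Theorems.FlatPortCurlCurlPairingAllL

end
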